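import Mathlib
import Summits.QuantumFields.BalabanUV.Beta.FP.PerfectFFBlockBounded

/-!
# `BalabanUV.Beta.FP.PerfectFFBlockRowSumTorus` — road «FP» (binder row D1), lane IR-5′, **THE (T0′) ROAD JUNCTION, FILE F4a (TORUS SIDE):
# ROW SUMS OF THE PERIODISED ff BLOCK** — `Σ_{y′∈Q} |Σ_t (unitK Mb sm (KTot N Mb))(x′, y′ + (nM)•t) ff| ≤ ½·N²·Mb^{1−d}·C` on every torus
# `(N, M)` whose hard covariance `𝒞` has the `ℓ^∞→ℓ^∞` letter `C` and which is large against `Q` (`Mb·(|y₁−y₂|_ν + 1) ≤ N·M_ν` on `Q`), plus the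
# symmetry of the ff block (our bookkeeping over g15∕g17's junction and an2's block-contour legs; no estimate of Bałaban's objects is proved here)

HONEST DEPENDENCY (page 1, mandatory): continuum YM on T⁴ ⇐ BetaPertH ∧ nine spine estimates (0/9 proved); BetaPertH ⇐ (D1) ∧ (D4) ∧
CAP+tail; G-an2-4 gates asym, D1 and NE2/3/4.  HONEST FRAMING (cell contract, verbatim): «discharging `BetaPertH` makes Bałaban's UV
stability UNCONDITIONAL — a real constructive-QFT result; it is NOT the continuum limit and NOT the Clay problem.»  THIS MODULE is finite bookkeeping
BY NAME over g17's `PerfectFFBlockBounded.tsum_unitK_KTot_ff_pshift_eq` (the coarse periodisation of the ff block of the unit-rescaled (j,m)-resolvent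
IS `(Mb²N²∕2)·Σ_{i,i′} legW·legW·Re 𝒞(p_i, q_{i′})`), an2's block-contour legs (`OneStepKernelFamily.LegIdx∕legPt∕legW∕sum_legW`), `KKTFluctuationEnergy.Gam_symm`,
and a joint fibre count of the leg map over a separated set of blocks; the covariance letter `C` is a HYPOTHESIS here (supplied on the tower tori by file 7
`CovarianceRowSumTower.exists_rowSum_Cov_tower` in F4b).  It cites nothing, mints no `Prop`, has no `def`, 0 sorry.  NOT (T0′) (F4b de-periodises and
passes to `j → ∞`), NOT hslice, NOT (ASYMP), NOT D1, NOT BetaPertH, NOT continuum, NOT Clay.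

ABSOLUTE RULE (cell charter, verbatim): «No internally-minted statement may enter as a cited fact. Every hypothesis is either kernel-proved in this
package or a verbatim quotation of a PUBLISHED theorem with page reference. The manuscript(s) under audit are NOT citable for their own disputed
steps — they are the thing under adjudication; programme-internal (2001/route/tribunal) claims are never citable.»

WHY ½·N²·Mb^{1−d} (`FF-LEG-LETTERS.md` v2 §4: `‖Γ_road‖_{∞→∞} = ½n²·Mb^{4−D}·‖𝒞‖_{∞→∞}`): the row `x′` of the periodised block is
`(Mb²N²∕2)·Σ_i legW_i Σ_{i′,y′} legW_{i′}·Re 𝒞(p_i, q_{i′}(y′))`; the leg map `(y′, i′) ↦ q_{i′}(y′)` (straight contours of length `Mb` from the block of `y′`)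
hits each fine bond at most `Mb` times over a separated `Q` (`card_legFibre_le`), `legW = Mb^{−(d+2)}`, `Σ_i legW_i = 1` — so the row sum is at most
`(Mb²N²∕2)·Mb^{−(d+2)}·Mb·C = ½N²Mb^{1−d}·C`; at `d = 3`, `N = n·Mb`: `½n²·C`, uniformly in `j`.

CONTENT.  §1 **`unitK_KTot_ff_symm`** (`(x′,κ) ↔ (y′,l)`); §2 generic `sum_comp_le_of_fibre` (`Σ_{a∈A} f(g a) ≤ m·Σ_b f b` for fibres `≤ m`, `f ≥ 0`),
**`card_legFibre_le`** (joint fibre count `≤ Mb` over a separated `Q`); §3 `sum_legW_norm_Cov_le` (the inner leg∕block sum against ONE row of `𝒞`),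
**`sum_abs_tsum_unitK_KTot_ff_pshift_le`** (the headline).
Unit `b2b-balaban-beta-d1-formalise-leaf-05` (gen 19), 2026-08-21; `LEAVES-FP.md` row «(T0′) ROAD JUNCTION F4a».  «not in print; our bookkeeping».
-/

noncomputable section

open scoped BigOperators Matrix ComplexConjugate
open Filter Topology

namespace Summit.QuantumFields.BalabanUV.Beta.FP.PerfectFFBlockRowSumTorus

open Matrix
open Literature.MathematicalPhysics.QuantumFieldTheory.Balaban1983to89
open Literature.MathematicalPhysics.QuantumFieldTheory.Balaban1983to89.Beta
open AffineAveraging (Site)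
open B5Prop11Plancherel (Tor fine)
open FluctuationProjection (Cov)
open KKTFluctuationKernel (Gam)
open KKTFluctuationEnergy (Gam_symm)
open OneStepResolventKernel (Fib)
open OneStepKernelFamily (LegIdx legPt legW legSet sum_legW legW_nonneg)
open Summit.QuantumFields.BalabanUV.Beta.HessKerDressedUnits (unitK)
open Summit.QuantumFields.BalabanUV.Beta.GAN24.TorusAvatar (toTor toTor_add)
open Summit.QuantumFields.BalabanUV.Beta.GAN24.TorusPeriodise (pshift)
open Summit.QuantumFields.BalabanUV.Beta.FP.PerfectObjects (KTot)
open Summit.QuantumFields.BalabanUV.Beta.FP.PerfectFFBlockTorus (legPt_inl_eq)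
open Summit.QuantumFields.BalabanUV.Beta.FP.PerfectFFBlockBounded (unitK_KTot_inl_inl tsum_unitK_KTot_ff_pshift_eq)

/-! ## §1 Symmetry of the ff block -/

section Symm

variable {d : ℕ} (N : ℕ) [NeZero N] (Mb : ℕ)

/-- [our object] **THE ff BLOCK IS SYMMETRIC under `(x′, κ) ↔ (y′, l)`** (`Gam_symm` inside the block-contour double sum). -/
theorem unitK_KTot_ff_symm (sf sm : ℝ) (x' y' : Site (d + 1)) (κ l : Fin (d + 1)) :
    unitK sf sm (KTot (d := d) N Mb) x' y' (Sum.inl κ) (Sum.inl l) = unitK sf sm (KTot (d := d) N Mb) y' x' (Sum.inl l) (Sum.inl κ) := by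
  have hS : (∑ i ∈ LegIdx d Mb, ∑ i' ∈ LegIdx d Mb, legW d Mb (Sum.inl κ : Fib d) * legW d Mb (Sum.inl l : Fib d) *
          Gam (N := N) κ (legPt (d := d) Mb (Sum.inl κ) x' i) l (legPt (d := d) Mb (Sum.inl l) y' i'))
      = ∑ i ∈ LegIdx d Mb, ∑ i' ∈ LegIdx d Mb, legW d Mb (Sum.inl l : Fib d) * legW d Mb (Sum.inl κ : Fib d) *
          Gam (N := N) l (legPt (d := d) Mb (Sum.inl l) y' i) κ (legPt (d := d) Mb (Sum.inl κ) x' i') := by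
    rw [Finset.sum_comm]
    refine Finset.sum_congr rfl fun i' _ => Finset.sum_congr rfl fun i _ => ?_
    rw [Gam_symm, mul_comm (legW d Mb (Sum.inl κ : Fib d)) (legW d Mb (Sum.inl l : Fib d))]
  rw [unitK_KTot_inl_inl, unitK_KTot_inl_inl, hS]

end Symm

/-! ## §2 Fibre sums and the joint fibre count of the leg map -/

section Fibre

/-- [folklore] **a sum through a map with fibres of size `≤ m` is at most `m` times the full sum** (`f ≥ 0`). -/
theorem sum_comp_le_of_fibre {α ι : Type*} [DecidableEq ι] [Fintype ι] (A : Finset α) (g : α → ι) (f : ι → ℝ)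
    (hf : ∀ b, 0 ≤ f b) {m : ℕ} (hm : ∀ b, (A.filter (fun a => g a = b)).card ≤ m) :
    ∑ a ∈ A, f (g a) ≤ m * ∑ b, f b := by
  rw [← Finset.sum_fiberwise_of_maps_to (s := A) (t := Finset.univ) (g := g) (fun _ _ => Finset.mem_univ _), Finset.mul_sum]
  refine Finset.sum_le_sum fun b _ => ?_
  have h : ∑ a ∈ A.filter (fun a => g a = b), f (g a) = ((A.filter (fun a => g a = b)).card : ℝ) * f b := by
    rw [Finset.sum_congr rfl (fun a ha => by rw [(Finset.mem_filter.mp ha).2]), Finset.sum_const, nsmul_eq_mul]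
  rw [h]
  exact mul_le_mul_of_nonneg_right (by exact_mod_cast hm b) (hf b)

variable {d : ℕ} (Mb : ℕ) {P : Fin (d + 1) → ℕ}

/-- [folklore] **THE JOINT FIBRE COUNT OF THE LEG MAP**: over a set of blocks `Q` separated against the periods (`Mb·|y₁ − y₂|_ν + Mb ≤ P_ν` on `Q`),
at most `Mb` pairs `(y′, i′) ∈ Q × LegIdx` of a field leg project to the same torus point — the contour step determines the pair (Euclidean division
`z = Mb•y′ + r`, `0 ≤ r < Mb`, after cancelling the step; g17's `PerfectFFBlockTorus.card_fibre_le` is the case `Q = {x′}`). -/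
theorem card_legFibre_le (l : Fin (d + 1)) (Q : Finset (Site (d + 1)))
    (hQ : ∀ y₁ ∈ Q, ∀ y₂ ∈ Q, ∀ ν, (Mb : ℤ) * |y₁ ν - y₂ ν| + Mb ≤ P ν) (z : Tor P) :
    ((Q ×ˢ LegIdx d Mb).filter (fun yi => toTor P (legPt (d := d) Mb (Sum.inl l) yi.1 yi.2) = z)).card ≤ Mb := by
  classical
  calc ((Q ×ˢ LegIdx d Mb).filter (fun yi => toTor P (legPt (d := d) Mb (Sum.inl l) yi.1 yi.2) = z)).card
      ≤ (Finset.range Mb).card := by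
        refine Finset.card_le_card_of_injOn (fun yi => yi.2.2) (fun yi hyi => ?_) ?_
        · have h := (Finset.mem_product.mp (Finset.mem_filter.mp hyi).1).2
          simp only [LegIdx, Finset.mem_product, Finset.mem_coe] at h ⊢
          exact h.2
        · intro a ha b hb hs
          obtain ⟨ya, ra, sa⟩ := a
          obtain ⟨yb, rb, sb⟩ := b
          have ha1 := Finset.mem_product.mp (Finset.mem_filter.mp (Finset.mem_coe.mp ha)).1
          have ha2 := (Finset.mem_filter.mp (Finset.mem_coe.mp ha)).2
          have hb1 := Finset.mem_product.mp (Finset.mem_filter.mp (Finset.mem_coe.mp hb)).1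
          have hb2 := (Finset.mem_filter.mp (Finset.mem_coe.mp hb)).2
          simp only at hs ha1 hb1 ha2 hb2
          subst hs
          simp only [LegIdx, Finset.mem_product, Fintype.mem_piFinset, Finset.mem_range] at ha1 hb1
          have heq : toTor P (legPt (d := d) Mb (Sum.inl l) ya (ra, sa)) = toTor P (legPt (d := d) Mb (Sum.inl l) yb (rb, sa)) := ha2.trans hb2.symm
          -- coordinatewise: `Mb·ya_μ + ra_μ ≡ Mb·yb_μ + rb_μ (mod P_μ)` and the difference is smaller than `P_μ`
          have hcoord : ∀ μ, (Mb : ℤ) * ya μ + ra μ = (Mb : ℤ) * yb μ + rb μ := by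
            intro μ
            have hμ := congrFun heq μ
            simp only [toTor, legPt_inl_eq, Pi.add_apply, Pi.smul_apply, smul_eq_mul, Int.cast_add, Int.cast_mul, Int.cast_natCast] at hμ
            have hμ' : (((Mb : ℤ) * ya μ + ra μ : ℤ) : ZMod (P μ)) = (((Mb : ℤ) * yb μ + rb μ : ℤ) : ZMod (P μ)) := by
              have := hμ
              push_cast at this ⊢
              rw [← add_assoc, ← add_assoc] at this
              exact add_right_cancel this
            have hdvd := (ZMod.intCast_eq_intCast_iff_dvd_sub _ _ _).mp hμ'
            have hra : (ra μ : ℤ) < Mb := by exact_mod_cast ha1.2.1 μ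
            have hrb : (rb μ : ℤ) < Mb := by exact_mod_cast hb1.2.1 μ
            have hsmall : |((Mb : ℤ) * yb μ + rb μ) - ((Mb : ℤ) * ya μ + ra μ)| < P μ := by
              have hq := hQ yb hb1.1 ya ha1.1 μ
              have h1 : |((Mb : ℤ) * yb μ + rb μ) - ((Mb : ℤ) * ya μ + ra μ)| ≤ (Mb : ℤ) * |yb μ - ya μ| + |(rb μ : ℤ) - ra μ| := by
                calc |((Mb : ℤ) * yb μ + rb μ) - ((Mb : ℤ) * ya μ + ra μ)| = |(Mb : ℤ) * (yb μ - ya μ) + ((rb μ : ℤ) - ra μ)| := by ring_nf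
                  _ ≤ |(Mb : ℤ) * (yb μ - ya μ)| + |(rb μ : ℤ) - ra μ| := abs_add_le _ _
                  _ = (Mb : ℤ) * |yb μ - ya μ| + |(rb μ : ℤ) - ra μ| := by rw [abs_mul, Nat.abs_cast]
              have h2 : |(rb μ : ℤ) - ra μ| < Mb := by
                rw [abs_sub_lt_iff]; constructor <;> linarith [Int.natCast_nonneg (ra μ), Int.natCast_nonneg (rb μ)]
              linarith
            exact (sub_eq_zero.mp (Int.eq_zero_of_abs_lt_dvd hdvd hsmall)).symm
          -- Euclidean division: `ya = yb` and `ra = rb`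
          have hy : ya = yb := by
            funext μ
            have h := hcoord μ
            have hra : (ra μ : ℤ) < Mb := by exact_mod_cast ha1.2.1 μ
            have hrb : (rb μ : ℤ) < Mb := by exact_mod_cast hb1.2.1 μ
            have h1 : (Mb : ℤ) * (ya μ - yb μ) = (rb μ : ℤ) - ra μ := by linarith
            have h2 : |(Mb : ℤ) * (ya μ - yb μ)| < Mb := by
              rw [h1, abs_sub_lt_iff]; constructor <;> linarith [Int.natCast_nonneg (ra μ), Int.natCast_nonneg (rb μ)]
            rw [abs_mul, Nat.abs_cast] at h2
            have h3 : |ya μ - yb μ| < 1 := by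
              by_contra hc
              push Not at hc
              have : (Mb : ℤ) * 1 ≤ (Mb : ℤ) * |ya μ - yb μ| := mul_le_mul_of_nonneg_left hc (Int.natCast_nonneg Mb)
              linarith
            have : ya μ - yb μ = 0 := Int.abs_lt_one_iff.mp h3
            linarith
          subst hy
          have hr : ra = rb := by
            funext μ
            have h := hcoord μ
            exact_mod_cast (add_left_cancel h : (ra μ : ℤ) = rb μ)
          subst hr
          rfl
    _ = Mb := Finset.card_range Mb

end Fibre

/-! ## §3 The row sum of the periodised ff block against one row of `𝒞` -/

section RowSum

variable {d : ℕ} (N : ℕ) [NeZero N] (hN : 1 ≤ N) (M : Fin (d + 1) → ℕ) [hM : ∀ ν, NeZero (M ν)] (Mb n : ℕ)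

include hN in
/-- [our bookkeeping] **THE INNER LEG∕BLOCK SUM AGAINST ONE ROW OF `𝒞`**: for a separated `Q` and any fine bond `p`,
`Σ_{y′∈Q} Σ_{i′∈LegIdx} legW·‖𝒞(p, (q_{i′}(y′), l))‖ ≤ legW·Mb·C` (`C` = the row-sum letter of `𝒞`; fibres `≤ Mb` by `card_legFibre_le`). -/
theorem sum_legW_norm_Cov_le {C : ℝ} (hC : ∀ i, ∑ j, ‖Cov N hN M 1 one_pos i j‖ ≤ C) (l : Fin (d + 1)) (Q : Finset (Site (d + 1)))
    (hQ : ∀ y₁ ∈ Q, ∀ y₂ ∈ Q, ∀ ν, (Mb : ℤ) * |y₁ ν - y₂ ν| + Mb ≤ fine N M ν) (p : Tor (fine N M) × Fin (d + 1)) :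
    ∑ y' ∈ Q, ∑ i' ∈ LegIdx d Mb, legW d Mb (Sum.inl l : Fib d) * ‖Cov N hN M 1 one_pos p (toTor (fine N M) (legPt (d := d) Mb (Sum.inl l) y' i'), l)‖
      ≤ legW d Mb (Sum.inl l : Fib d) * (Mb * C) := by
  classical
  rw [← Finset.sum_product (s := Q) (t := LegIdx d Mb)
    (f := fun yi => legW d Mb (Sum.inl l : Fib d) * ‖Cov N hN M 1 one_pos p (toTor (fine N M) (legPt (d := d) Mb (Sum.inl l) yi.1 yi.2), l)‖),
    ← Finset.mul_sum]
  refine mul_le_mul_of_nonneg_left ?_ (legW_nonneg (d := d) Mb _)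
  have hfib := sum_comp_le_of_fibre (Q ×ˢ LegIdx d Mb) (fun yi => toTor (fine N M) (legPt (d := d) Mb (Sum.inl l) yi.1 yi.2))
    (fun z => ‖Cov N hN M 1 one_pos p (z, l)‖) (fun _ => norm_nonneg _) (card_legFibre_le Mb l Q hQ)
  refine hfib.trans (mul_le_mul_of_nonneg_left ?_ (Nat.cast_nonneg Mb))
  -- the `l`-slice of the row is at most the whole row
  calc ∑ z : Tor (fine N M), ‖Cov N hN M 1 one_pos p (z, l)‖
      ≤ ∑ z : Tor (fine N M), ∑ l' : Fin (d + 1), ‖Cov N hN M 1 one_pos p (z, l')‖ :=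
        Finset.sum_le_sum fun z _ => Finset.single_le_sum (f := fun l' => ‖Cov N hN M 1 one_pos p (z, l')‖) (fun _ _ => norm_nonneg _)
          (Finset.mem_univ l)
    _ = ∑ j, ‖Cov N hN M 1 one_pos p j‖ := by rw [← Fintype.sum_prod_type']
    _ ≤ C := hC p

include hN in
/-- [our bookkeeping] **ROW SUMS OF THE PERIODISED ff BLOCK**: for `N = n·Mb`, `Mb ≥ 1`, a torus `(N, M)` with covariance row-sum letter `C`, and a set of
blocks `Q` separated against the coarse periods (`Mb·|y₁ − y₂|_ν + Mb ≤ N·M_ν` on `Q`):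
`Σ_{y′∈Q} |Σ_t (unitK Mb sm (KTot N Mb))(x′, y′ + (nM)•t) ff| ≤ (Mb²N²∕2)·legW·Mb·C` (`legW = Mb^{−(d+2)}`; at `d = 3` this is `½·(N∕Mb)²·C`). -/
theorem sum_abs_tsum_unitK_KTot_ff_pshift_le (hMb : 1 ≤ Mb) (hMbN : N = n * Mb) {C : ℝ}
    (hC : ∀ i, ∑ j, ‖Cov N hN M 1 one_pos i j‖ ≤ C) (sm : ℝ) (x' : Site (d + 1)) (κ l : Fin (d + 1)) (Q : Finset (Site (d + 1)))
    (hQ : ∀ y₁ ∈ Q, ∀ y₂ ∈ Q, ∀ ν, (Mb : ℤ) * |y₁ ν - y₂ ν| + Mb ≤ fine N M ν) :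
    ∑ y' ∈ Q, |∑' t : Site (d + 1), unitK (Mb : ℝ) sm (KTot (d := d) N Mb) x' (y' + pshift (fine n M) t) (Sum.inl κ) (Sum.inl l)|
      ≤ ((Mb : ℝ) ^ 2 * (N : ℝ) ^ 2 / 2) * (legW d Mb (Sum.inl l : Fib d) * (Mb * C)) := by
  have hMb0 : Mb ≠ 0 := by omega
  have hpos : 0 ≤ (Mb : ℝ) ^ 2 * (N : ℝ) ^ 2 / 2 := by positivity
  have hwκ : 0 ≤ legW d Mb (Sum.inl κ : Fib d) := legW_nonneg (d := d) Mb _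
  have hwl : 0 ≤ legW d Mb (Sum.inl l : Fib d) := legW_nonneg (d := d) Mb _
  -- each term through the junction, then the triangle inequality
  have hterm : ∀ y' ∈ Q,
      |∑' t : Site (d + 1), unitK (Mb : ℝ) sm (KTot (d := d) N Mb) x' (y' + pshift (fine n M) t) (Sum.inl κ) (Sum.inl l)|
        ≤ ((Mb : ℝ) ^ 2 * (N : ℝ) ^ 2 / 2) * ∑ i ∈ LegIdx d Mb, legW d Mb (Sum.inl κ : Fib d) *
            ∑ i' ∈ LegIdx d Mb, legW d Mb (Sum.inl l : Fib d) *
              ‖Cov N hN M 1 one_pos (toTor (fine N M) (legPt (d := d) Mb (Sum.inl κ) x' i), κ)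
                (toTor (fine N M) (legPt (d := d) Mb (Sum.inl l) y' i'), l)‖ := by
    intro y' _
    rw [tsum_unitK_KTot_ff_pshift_eq N hN M Mb n hMbN sm x' y' κ l, abs_mul, abs_of_nonneg hpos]
    refine mul_le_mul_of_nonneg_left ?_ hpos
    refine (Finset.abs_sum_le_sum_abs _ _).trans (Finset.sum_le_sum fun i _ => ?_)
    rw [Finset.mul_sum]
    refine (Finset.abs_sum_le_sum_abs _ _).trans (Finset.sum_le_sum fun i' _ => ?_)
    rw [abs_mul, abs_mul, abs_of_nonneg hwκ, abs_of_nonneg hwl, mul_assoc]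
    exact mul_le_mul_of_nonneg_left (mul_le_mul_of_nonneg_left (Complex.abs_re_le_norm _) hwl) hwκ
  refine (Finset.sum_le_sum hterm).trans ?_
  rw [← Finset.mul_sum]
  refine mul_le_mul_of_nonneg_left ?_ hpos
  -- swap the `y′` and `i` sums and use §3's inner bound for each leg point `p_i`
  rw [Finset.sum_comm]
  calc ∑ i ∈ LegIdx d Mb, ∑ y' ∈ Q, legW d Mb (Sum.inl κ : Fib d) *
          ∑ i' ∈ LegIdx d Mb, legW d Mb (Sum.inl l : Fib d) *
            ‖Cov N hN M 1 one_pos (toTor (fine N M) (legPt (d := d) Mb (Sum.inl κ) x' i), κ)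
              (toTor (fine N M) (legPt (d := d) Mb (Sum.inl l) y' i'), l)‖
      = ∑ i ∈ LegIdx d Mb, legW d Mb (Sum.inl κ : Fib d) *
          ∑ y' ∈ Q, ∑ i' ∈ LegIdx d Mb, legW d Mb (Sum.inl l : Fib d) *
            ‖Cov N hN M 1 one_pos (toTor (fine N M) (legPt (d := d) Mb (Sum.inl κ) x' i), κ)
              (toTor (fine N M) (legPt (d := d) Mb (Sum.inl l) y' i'), l)‖ := by
        refine Finset.sum_congr rfl fun i _ => ?_
        rw [Finset.mul_sum]
    _ ≤ ∑ i ∈ LegIdx d Mb, legW d Mb (Sum.inl κ : Fib d) * (legW d Mb (Sum.inl l : Fib d) * (Mb * C)) :=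
        Finset.sum_le_sum fun i _ => mul_le_mul_of_nonneg_left (sum_legW_norm_Cov_le N hN M Mb hC l Q hQ _) hwκ
    _ = legW d Mb (Sum.inl l : Fib d) * (Mb * C) := by
        rw [← Finset.sum_mul]
        have h1 : ∑ _i ∈ LegIdx d Mb, legW d Mb (Sum.inl κ : Fib d) = 1 := sum_legW (d := d) hMb0 (Sum.inl κ)
        rw [h1, one_mul]

end RowSum

end Summit.QuantumFields.BalabanUV.Beta.FP.PerfectFFBlockRowSumTorus

end
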